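import Summits.NavierStokesRegularity.NavierStokesRegularity.Theses.PalasekTowerBreakdown
import Summits.NavierStokesRegularity.NavierStokesRegularity.Theorems.HeredityAtOne.Negative.ForcedNoSwirlGlobalHolds

/-!
# `¬ HeredityFromTwoT` (and the heredity PAIR) from ONE globally solvable / swirl-free registered TUNED design

Cell `ns-blowup`, seat refuter4 (g9), K-row K201 — refuter of record of route `PalasekTowerBreakdown`
rev 19 (RE-BASE at `TowerRates.tuned = (2^24, 33/32, 12/5, 49/20)`; cruxes stmt-NavierStokesRegularity-20304
`HeredityAtOneT`, -20305 `HeredityFromTwoT`, -20303 `EpisodeBaseT`). NEGATIVE-LANE support lemmas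
(`--supports` 20305), the `R`-GENERIC port of the wide global-solution / no-swirl levers of record
(`Theorems/HeredityFromTwo/Negative/GlobalDesigns.lean` §2–§4, `Theorems/HeredityAtOne/Negative/
HeredityAtOneFalseOfCappedStageAtOne.lean` §3, `…/ForcedNoSwirlGlobalHolds.lean`), whose SCHEDULE-level
machinery (`Schedule.false_of_nonempty_stages_of_global_classical`, `Schedule.exists_last_level_of_global_classical`,
`NoSwirlDesign`, `forcedNoSwirlGlobal_holds`) is already typed at arbitrary rates `R`; only the
`HeredityFrom`-level corollaries were pinned to `TowerRates.wide`. LABEL: refuter kernel certificate (E–C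
typing; every analytic input — forced Ladyzhenskaya–Ukhovskii–Yudovich, Tao's forced uniqueness — is a
DISCHARGED theorem of the tree). WHAT THIS IS NOT: not Navier–Stokes evidence; no schedule, stage, design
or tower is constructed; no item is refuted — the premise of every lever is the OPEN witness class
`NoSwirlRungGAt R k₀` (resp. an inline «globally solvable registered design»).

WHY NOW (the point of the port). At `wide` the premise was filed «empty-in-practice» (scoping numerics:
swirl-free free amplification `μ ≤ 1.17 … 1.42 < Y₁/Y₀ ≈ 2.056`, K61 / S-RING-1 / P-RING-0). At `tuned`
(`Re₀ = 2^{48/5} ≈ 776`, window `= 169.85` level-0 strain times) the crux-strategist's LIVE line for the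
∃-crux `EpisodeBaseT` («mirrorT», STATUS 2026-08-27 l.9317: the head-on MIRROR RING PAIR in the swirl-free
axisymmetric class, global existence being the tree's `forcedNoSwirlGlobal_holds`) targets EXACTLY an
inhabitant of `NoSwirlRungAtOneT := NoSwirlRungGAt tuned 1`. This file types, BY THE ROUTE'S DECL NAMES,
what such an inhabitant decides:

* `HeredityFromTwoT_false_of_noSwirlRungAtOneT_of_heredityAtOneT` — a swirl-free registered tuned level-1
  stage refutes `HeredityFromTwoT` GIVEN `HeredityAtOneT` (i.e. it kills the PAIR 20304 ∧ 20305 that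
  `closes` consumes; cstrat-19179 g1's «DECIDER» flag, kernel-checked);
* `HeredityAtOneT_false_or_HeredityFromTwoT_false_of_noSwirlRungAtOneT` — cap-free, it breaks ONE of the
  two binders at a definite but undecided rung (`NoSwirlRungGAt.exists_not_heredityAtGAt`);
* `HeredityFromTwoT_false_of_noSwirlRungGAt` — a swirl-free registered tuned stage at any level `k₀ ≥ 2`
  refutes `HeredityFromTwoT` outright; `HeredityFromTwoT_false_of_global_design` — so does any registered
  tuned design reaching a level `≥ 2` whose forced Cauchy problem is globally classically solvable;
* `isEmpty_noSwirl_stage_tuned_of_heredity_pair` — conversely 20304 ∧ 20305 EMPTY the swirl-free class at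
  every level `≥ 1` on the tuned rates: along the mirrorT line the route's three cruxes cannot all hold.

Filed as PLAIN negative lemmas (no `--negative-modulo` hold): the planner already holds 20304 on
`SubfloorStageAtOneT` (p525716) and owns the allocation call; this file only makes the fork explicit.

References: O. A. Ladyzhenskaya (1968), M. R. Ukhovskii – V. I. Yudovich (1968) through
P. G. Lemarié-Rieusset, *The Navier–Stokes Problem in the 21st Century* (CRC 2016), Thm 10.4 (p. 285)
[cite: LemarieRieusset2016, Thm 10.4 (p. 285)]; T. Tao, Anal. PDE 6 (2013), Cor. 11.4
[cite: Tao2011, Cor. 11.4]; S. Palasek, arXiv:2605.13827 §4 [cite: Palasek2026ElementaryModel, §4];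
C. L. Fefferman, Clay problem description (2006), (C) [cite: FeffermanClay2006, (C)].
-/

noncomputable section

/-! ## §1 The lever against `HeredityFromGAt R k₀` — every rates record `R`, every starting level, no cap
(in the register's namespace, next to `HeredityFromGAt.mono` / `.heredityAt`, so that dot-notation works) -/

namespace Summit.NavierStokesRegularity.FluidComputer.PalasekTowerClayBridge

open Set MeasureTheory Filter Topology Function
open scoped ENNReal ContDiff NNReal
open Literature.Analysis.FluidPDE
open Summit.NavierStokesRegularity.HeredityAtOneSpeedCap

section Lever

variable {R : TowerRates} {S : Schedule R} {k₀ : ℕ}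

/-- **Up the ladder** under `HeredityFromGAt R k₀`: a registered level-`k₀` stage of a pinned rigid quiet
schedule on `R` gives a registered stage of the same schedule at every level `k ≥ k₀`.
[cite: Palasek2026ElementaryModel, §4] -/
theorem HeredityFromGAt.nonempty_stage_of_le (h : HeredityFromGAt R k₀) (hP : S.Pins 8 (6 / 5))
    (hR : S.Rigid) (hQ : S.Quiet) (s : Stage 1 R S (Margins.routeG R) k₀) {k : ℕ} (hk : k₀ ≤ k) :
    Nonempty (Stage 1 R S (Margins.routeG R) k) := by
  induction k, hk using Nat.le_induction with
  | base => exact ⟨s⟩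
  | succ k hk ih =>
    obtain ⟨s'⟩ := ih
    obtain ⟨s'', -⟩ := h S hP hR hQ k hk s'
    exact ⟨s''⟩

/-- **Up and down**: under `HeredityFromGAt R k₀`, ONE registered level-`k₀` stage of a pinned rigid quiet
schedule gives a registered stage at EVERY level (down by `Stage.restrictOfAntitone`,
`Margins.antitone_routeG`). [cite: Palasek2026ElementaryModel, §4] -/
theorem HeredityFromGAt.nonempty_stage_all (h : HeredityFromGAt R k₀) (hP : S.Pins 8 (6 / 5))
    (hR : S.Rigid) (hQ : S.Quiet) (s : Stage 1 R S (Margins.routeG R) k₀) (k : ℕ) :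
    Nonempty (Stage 1 R S (Margins.routeG R) k) := by
  obtain ⟨s'⟩ := h.nonempty_stage_of_le hP hR hQ s (le_max_right k k₀)
  exact ⟨s'.restrictOfAntitone (Margins.antitone_routeG R) (le_max_left k k₀)⟩

/-- **`HeredityFromGAt R k₀` + ONE registered level-`k₀` stage with a globally solvable design is absurd**
(the design then reaches every level and realises the tower with its own datum and force;
`Schedule.false_of_nonempty_stages_of_global_classical`, Tao's forced uniqueness discharged).
[cite: Tao2011, Cor. 11.4] -/
theorem HeredityFromGAt.false_of_global_classical (h : HeredityFromGAt R k₀) (hP : S.Pins 8 (6 / 5))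
    (hR : S.Rigid) (hQ : S.Quiet) (s : Stage 1 R S (Margins.routeG R) k₀)
    {v : ℝ → EuclideanSpace ℝ (Fin 3) → EuclideanSpace ℝ (Fin 3)}
    {q : ℝ → EuclideanSpace ℝ (Fin 3) → ℝ}
    (hcl : IsClassicalNSSolutionOn (Ici 0) 1 S.f v q) (h0 : v 0 = S.u₀) (hE : HasBoundedEnergy v) :
    False :=
  S.false_of_nonempty_stages_of_global_classical one_pos (h.nonempty_stage_all hP hR hQ s) hcl h0 hE

/-- **THE GLOBAL-SOLUTION LEVER at `(R, k₀)`**, packaged: SOME pinned (`Λ = 8`, `θ = 6/5`) rigid quiet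
schedule on the rates `R` with a registered level-`k₀` stage whose design `(u₀, f)` has a global
finite-energy classical solution refutes `HeredityFromGAt R k₀`. No cap, no symmetry.
[cite: Tao2011, Cor. 11.4] -/
theorem not_heredityFromGAt_of_global_design
    (h : ∃ (S : Schedule R) (_ : Stage 1 R S (Margins.routeG R) k₀)
      (v : ℝ → EuclideanSpace ℝ (Fin 3) → EuclideanSpace ℝ (Fin 3))
      (q : ℝ → EuclideanSpace ℝ (Fin 3) → ℝ),
      S.Pins 8 (6 / 5) ∧ S.Rigid ∧ S.Quiet ∧
      IsClassicalNSSolutionOn (Ici 0) 1 S.f v q ∧ v 0 = S.u₀ ∧ HasBoundedEnergy v) :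
    ¬ HeredityFromGAt R k₀ := by
  rintro hH
  obtain ⟨S, s, v, q, hP, hR, hQ, hcl, h0, hE⟩ := h
  exact hH.false_of_global_classical hP hR hQ s hcl h0 hE

/-- **`HeredityFromGAt R k₀` EMPTIES THE UNFORCED AXISYMMETRIC SWIRL-FREE CLASS AT LEVEL `k₀`** on any
rates (two-signed `ω_θ` included; regularity and uniqueness are theorems of the tree).
[cite: LemarieRieusset2016, Thm 10.4 (p. 285)] -/
theorem HeredityFromGAt.isEmpty_stage_of_noSwirl (h : HeredityFromGAt R k₀) (hP : S.Pins 8 (6 / 5))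
    (hR : S.Rigid) (hQ : S.Quiet) (hf : S.f = 0) (hA : IsAxisymmetric S.u₀) (hS : HasNoSwirl S.u₀) :
    IsEmpty (Stage 1 R S (Margins.routeG R) k₀) :=
  ⟨fun s => S.not_axisym_noSwirl_of_nonempty_stages one_pos (h.nonempty_stage_all hP hR hQ s) hf
    ⟨hA, hS⟩⟩

/-- **Witness class `H_𝒮(R, k₀)`** (hypothesis, never asserted): an axisymmetric swirl-free pinned
(`Λ = 8`, `θ = 6/5`) rigid quiet design ON THE RATES `R` carrying a registered stage at level `k₀` — the
`R`-generic form of the wide `NoSwirlRung k₀` (definitionally, see the closing `example`); at `(tuned, 1)` it is the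
target class of the crux-strategist's «mirrorT» line for `EpisodeBaseT`. OPEN.
[cite: Palasek2026ElementaryModel, §4] -/
@[conjecture] def NoSwirlRungGAt (R : TowerRates) (k₀ : ℕ) : Prop :=
  ∃ S : Schedule R, S.Pins 8 (6 / 5) ∧ S.Rigid ∧ S.Quiet ∧ NoSwirlDesign S ∧
    Nonempty (Stage 1 R S (Margins.routeG R) k₀)

/-- **`H_𝒮(R, k₀) → ¬ HeredityFromGAt R k₀`** — a FORCED axisymmetric swirl-free pinned rigid quiet design
on `R` carrying a registered level-`k₀` stage refutes heredity from `k₀`: its datum is smooth,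
divergence-free (the `t = 0` slice of the stage) and rapidly decaying, its force Clay-class, so the tree's
`forcedNoSwirlGlobal_holds` hands the global-solution lever its global solution.
[cite: LemarieRieusset2016, Thm 10.4 (p. 285)] -/
theorem not_heredityFromGAt_of_noSwirlRungGAt (hW : NoSwirlRungGAt R k₀) : ¬ HeredityFromGAt R k₀ := by
  obtain ⟨S, hP, hR, hQ, hN, ⟨s⟩⟩ := hW
  have hdiv : VectorCalculus.IsDivFree S.u₀ := by
    rw [← s.initial]
    exact s.classical.divFree 0 ⟨le_rfl, (S.τ_pos k₀).le⟩
  obtain ⟨U, P, hcl, hU0, hE⟩ := forcedNoSwirlGlobal_holds S.u₀ S.f s.contDiff_datum hdiv S.datum_decay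
    hN.1 hN.2.1 S.force_smooth S.force_decay (fun t ht => ⟨hN.2.2.1 t ht, hN.2.2.2 t ht⟩)
  exact not_heredityFromGAt_of_global_design ⟨S, s, U, P, hP, hR, hQ, hcl, hU0, hE⟩

/-- **A swirl-free registered design on `R` reaching level `k₀` breaks heredity AT A DEFINITE RUNG
`k ≥ k₀`** — the last level it reaches (`Schedule.exists_last_level_of_global_classical` on the global
solution of `forcedNoSwirlGlobal_holds`). Which `k` is not decided without a quantitative cap.
[cite: LemarieRieusset2016, Thm 10.4 (p. 285)] -/
theorem NoSwirlRungGAt.exists_not_heredityAtGAt (hW : NoSwirlRungGAt R k₀) :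
    ∃ k, k₀ ≤ k ∧ NoSwirlRungGAt R k ∧ ¬ HeredityAtGAt R k := by
  obtain ⟨S, hP, hR, hQ, hN, ⟨s⟩⟩ := hW
  have hdiv : VectorCalculus.IsDivFree S.u₀ := by
    rw [← s.initial]
    exact s.classical.divFree 0 ⟨le_rfl, (S.τ_pos k₀).le⟩
  obtain ⟨U, P, hcl, hU0, hE⟩ := forcedNoSwirlGlobal_holds S.u₀ S.f s.contDiff_datum hdiv S.datum_decay
    hN.1 hN.2.1 S.force_smooth S.force_decay (fun t ht => ⟨hN.2.2.1 t ht, hN.2.2.2 t ht⟩)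
  obtain ⟨k, hk, ⟨s'⟩, he⟩ := S.exists_last_level_of_global_classical one_pos s hcl hU0 hE
  refine ⟨k, hk, ⟨S, hP, hR, hQ, hN, ⟨s'⟩⟩, fun hH => ?_⟩
  obtain ⟨s'', -⟩ := hH S hP hR hQ s'
  exact he.false s''

/-- **The dichotomy the ∀-binders carry at `R`**: heredity at `1` and from `2` on `R` EMPTY the forced
axisymmetric swirl-free class at every level `k₀ ≥ 1` — a Liouville-type non-existence statement inside
the quantified class. [cite: LemarieRieusset2016, Thm 10.4 (p. 285)] -/
theorem isEmpty_noSwirl_stage_of_heredityGAt (h₁ : HeredityAtGAt R 1) (h₂ : HeredityFromGAt R 2)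
    (hP : S.Pins 8 (6 / 5)) (hR : S.Rigid) (hQ : S.Quiet) (hN : NoSwirlDesign S) (hk : 1 ≤ k₀) :
    IsEmpty (Stage 1 R S (Margins.routeG R) k₀) :=
  ⟨fun s => not_heredityFromGAt_of_noSwirlRungGAt ⟨S, hP, hR, hQ, hN, ⟨s⟩⟩
    ((episodeInductionGAt_of_heredity h₁ h₂).mono hk)⟩

end Lever

end Summit.NavierStokesRegularity.FluidComputer.PalasekTowerClayBridge

/-! ## §2 By the route's decl names at `TowerRates.tuned` (`Theses/PalasekTowerBreakdown.lean` rev 19) -/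

namespace Summit.NavierStokesRegularity.HeredityFromTwoTNoSwirl

open Set MeasureTheory Filter Topology Function
open scoped ENNReal ContDiff NNReal
open Literature.Analysis.FluidPDE
open Summit.NavierStokesRegularity.FluidComputer.PalasekTowerClayBridge
open Summit.NavierStokesRegularity.HeredityAtOneSpeedCap
open Summit.NavierStokesRegularity.NavierStokesRegularity.Theses

/-- **`H_𝒮(tuned, 1)`** (hypothesis, never asserted): a swirl-free pinned rigid quiet TUNED design with a
registered LEVEL-1 stage — the class the «mirrorT» line for `EpisodeBaseT` aims to inhabit (any
inhabitant proves `EpisodeBaseT` outright: `⟨S, hP, hR, hQ, ⟨s⟩⟩`). [cite: Palasek2026ElementaryModel, §4] -/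
@[conjecture] def NoSwirlRungAtOneT : Prop := NoSwirlRungGAt TowerRates.tuned 1

/-- **Item 20305 `HeredityFromTwoT` is refuted by a swirl-free registered tuned stage at any level
`k₀ ≥ 2`** (`HeredityFromGAt.mono` + the lever). [cite: LemarieRieusset2016, Thm 10.4 (p. 285)] -/
theorem HeredityFromTwoT_false_of_noSwirlRungGAt {k₀ : ℕ} (hk : 2 ≤ k₀)
    (hW : NoSwirlRungGAt TowerRates.tuned k₀) : ¬ PalasekTowerBreakdown.HeredityFromTwoT :=
  fun h => not_heredityFromGAt_of_noSwirlRungGAt hW (HeredityFromGAt.mono h hk)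

/-- **Item 20305 is refuted by any registered tuned design reaching a level `k₀ ≥ 2` whose forced Cauchy
problem has a global finite-energy classical solution** — no cap, no symmetry. [cite: Tao2011, Cor. 11.4] -/
theorem HeredityFromTwoT_false_of_global_design
    (h : ∃ (S : Schedule TowerRates.tuned) (k₀ : ℕ)
      (_ : Stage 1 TowerRates.tuned S (Margins.routeG TowerRates.tuned) k₀)
      (v : ℝ → EuclideanSpace ℝ (Fin 3) → EuclideanSpace ℝ (Fin 3))
      (q : ℝ → EuclideanSpace ℝ (Fin 3) → ℝ),
      2 ≤ k₀ ∧ S.Pins 8 (6 / 5) ∧ S.Rigid ∧ S.Quiet ∧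
      IsClassicalNSSolutionOn (Ici 0) 1 S.f v q ∧ v 0 = S.u₀ ∧ HasBoundedEnergy v) :
    ¬ PalasekTowerBreakdown.HeredityFromTwoT := by
  rintro hH
  obtain ⟨S, k₀, s, v, q, hk₀, hP, hR, hQ, hcl, h0, hE⟩ := h
  exact (HeredityFromGAt.mono hH hk₀).false_of_global_classical hP hR hQ s hcl h0 hE

/-- **Conversely, 20304 ∧ 20305 EMPTY the swirl-free class on the tuned rates at every level `≥ 1`**: under
the heredity pair no axisymmetric swirl-free pinned rigid quiet tuned design registers a stage at any level
`k₀ ≥ 1` — in particular none witnesses `EpisodeBaseT`. [cite: LemarieRieusset2016, Thm 10.4 (p. 285)] -/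
theorem isEmpty_noSwirl_stage_tuned_of_heredity_pair (h₁ : PalasekTowerBreakdown.HeredityAtOneT)
    (h₂ : PalasekTowerBreakdown.HeredityFromTwoT) {S : Schedule TowerRates.tuned} (hP : S.Pins 8 (6 / 5))
    (hR : S.Rigid) (hQ : S.Quiet) (hN : NoSwirlDesign S) {k₀ : ℕ} (hk : 1 ≤ k₀) :
    IsEmpty (Stage 1 TowerRates.tuned S (Margins.routeG TowerRates.tuned) k₀) :=
  isEmpty_noSwirl_stage_of_heredityGAt h₁ h₂ hP hR hQ hN hk

/-- **THE DECIDER (cstrat-19179 g1, kernel): a swirl-free registered tuned LEVEL-1 stage refutes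
`HeredityFromTwoT` GIVEN `HeredityAtOneT`** — the pair is `EpisodeInductionGAt tuned = HeredityFromGAt
tuned 1` (`episodeInductionGAt_of_heredity`), which the level-1 lever kills. So an `EpisodeBaseT` witness in
the swirl-free class is INCOMPATIBLE with 20304 ∧ 20305 as typed. [cite: LemarieRieusset2016, Thm 10.4 (p. 285)] -/
theorem HeredityFromTwoT_false_of_noSwirlRungAtOneT_of_heredityAtOneT (hW : NoSwirlRungAtOneT)
    (h₁ : PalasekTowerBreakdown.HeredityAtOneT) : ¬ PalasekTowerBreakdown.HeredityFromTwoT := by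
  rintro h₂
  obtain ⟨S, hP, hR, hQ, hN, ⟨s⟩⟩ := hW
  exact (isEmpty_noSwirl_stage_tuned_of_heredity_pair h₁ h₂ hP hR hQ hN le_rfl).false s

/-- **Item 20305 is refuted by any registered UNFORCED tuned design with axisymmetric swirl-free datum
reaching a level `k₀ ≥ 2`** — the sub-case `S.f = 0` needs only the unforced Ladyzhenskaya–Ukhovskii–Yudovich
theorem of the tree (`HeredityFromGAt.isEmpty_stage_of_noSwirl`). [cite: LemarieRieusset2016, Thm 10.4 (p. 285)] -/
theorem HeredityFromTwoT_false_of_unforced_noSwirl_design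
    (h : ∃ (S : Schedule TowerRates.tuned) (k₀ : ℕ)
      (_ : Stage 1 TowerRates.tuned S (Margins.routeG TowerRates.tuned) k₀),
      2 ≤ k₀ ∧ S.Pins 8 (6 / 5) ∧ S.Rigid ∧ S.Quiet ∧ S.f = 0 ∧
      IsAxisymmetric S.u₀ ∧ HasNoSwirl S.u₀) :
    ¬ PalasekTowerBreakdown.HeredityFromTwoT := by
  rintro hH
  obtain ⟨S, k₀, s, hk₀, hP, hR, hQ, hf, hA, hS⟩ := h
  exact ((HeredityFromGAt.mono hH hk₀).isEmpty_stage_of_noSwirl hP hR hQ hf hA hS).false s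

/-- **Cap-free, a swirl-free registered tuned level-1 stage breaks ONE of the two binders at a definite
rung**: `¬ HeredityAtOneT` (the design's last level is `1`) or `¬ HeredityFromTwoT` (it is `≥ 2`); which
one needs a quantitative cap (the sub-floor template `SubfloorStageAtOneT`, p525716, is the `k = 1` case).
[cite: LemarieRieusset2016, Thm 10.4 (p. 285)] -/
theorem HeredityAtOneT_false_or_HeredityFromTwoT_false_of_noSwirlRungAtOneT (hW : NoSwirlRungAtOneT) :
    ¬ PalasekTowerBreakdown.HeredityAtOneT ∨ ¬ PalasekTowerBreakdown.HeredityFromTwoT := by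
  obtain ⟨k, hk, -, hH⟩ := NoSwirlRungGAt.exists_not_heredityAtGAt hW
  rcases Nat.lt_or_ge k 2 with hlt | hge
  · have hk1 : k = 1 := by omega
    subst hk1
    exact Or.inl hH
  · exact Or.inr fun h₂ => hH (HeredityFromGAt.heredityAt h₂ hge)

/-- … packaged at level `1`: the heredity pair refutes `NoSwirlRungAtOneT` — the mirrorT target class is
EMPTY under 20304 ∧ 20305 (through the definite-rung dichotomy). [cite: LemarieRieusset2016, Thm 10.4 (p. 285)] -/
theorem not_noSwirlRungAtOneT_of_heredity_pair (h₁ : PalasekTowerBreakdown.HeredityAtOneT)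
    (h₂ : PalasekTowerBreakdown.HeredityFromTwoT) : ¬ NoSwirlRungAtOneT := fun hW => by
  rcases HeredityAtOneT_false_or_HeredityFromTwoT_false_of_noSwirlRungAtOneT hW with h | h
  · exact h h₁
  · exact h h₂

/-- Sanity at `R = wide`: the generic lever at `(wide, k₀)` is the wide record's
`NoSwirlRung.not_heredityFrom` verbatim (`Iff.rfl` identities). [folklore] -/
example {k₀ : ℕ} (hW : NoSwirlRung k₀) : ¬ HeredityFrom k₀ :=
  (heredityFromGAt_wide_iff k₀).1.mt
    (not_heredityFromGAt_of_noSwirlRungGAt ((Iff.rfl : NoSwirlRungGAt TowerRates.wide k₀ ↔ NoSwirlRung k₀).2 hW))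

end Summit.NavierStokesRegularity.HeredityFromTwoTNoSwirl

end
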